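import Summits.BirchSwinnertonDyer.BirchSwinnertonDyer.Theorems.RamifiedHeegnerPairTwistUnitSaving
import HarnessLib

/-!
# U₀ at the SAVING ROWS of the Gss2 census (rank zero), TU₀|saving — part G: `217854bo1`, `242550ot1`

Continuation of `…Theorems.RamifiedHeegnerPairTwistUnitSaving` (seat `bsd-trib-w-rhp` g15; doors, framing and data provenance there; generic kernel lemmas g14's `…TwistUnitInert`):
per rank zero curve `subGss_three_/Δ_eq_/c₄_eq_/krausList_/surj_three_<label>` IN THE KERNEL, Kraus minimality of `V = E^{(-3)}_min` and of the twist model `Wd`, and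
`u0s_at_<label> : … → MissingUpperBoundAt W 3` by p674548 `LeafShimuraInert.leafRankZeroUpper_three_of_shimuraInertDatum_at_saving_of_twistUnitZero` through
`leafRankZeroUpper_three_at_saving_of_sqrtField` — printed facts `hGZK hmod hnf hJL hCO hPrim` as hypotheses; `q₁ ∣ Δ_min`, multiplicative / no-split / Tate certificates, `hFC`, `hshape` off `q₁`, (DEG), field
congruences IN THE KERNEL; `hN hr Dt hc` + `L(E^D,1) = 0 ≠ L′(E^D,1)` + `#Ш(Wd)_an` DISPLAYED.  **HONEST FRAMING: theorems only; nothing booked, no item closed; U₀ (26024) / TU|saving / the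
Shimura-curve Heegner-system inputs stay research-level and OPEN class-wide; BSD is NOT proved for any curve by this file.**
[cite: JetchevSkinnerWan2017, §7.4.2 (p. 31)] [cite: PastenShimura2024, Prop. 6.13, Lemma 6.15, Lemma 6.18] [cite: Serre1972, §2.8] [cite: Kraus1989, Prop. 1] [cite: Cremona2006, Table 1]
-/

set_option linter.dupNamespace false
set_option autoImplicit false

noncomputable section

open scoped Classical NumberField

open WeierstrassCurve NumberField IsDedekindDomain IsDedekindDomain.HeightOneSpectrum Rat.HeightOneSpectrum Field Literature Literature.NumberTheory.DiophantineGeometry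
  Literature.NumberTheory.EllipticCurves Literature.NumberTheory.EllipticCurves.ModularForms Literature.NumberTheory.EllipticCurves.Rank1Residual
  Literature.NumberTheory.EllipticCurves.Rank1Residual.Typed Literature.NumberTheory.Automorphic Literature.NumberTheory.EllipticCurves.Rank1Residual.X11RankOneCertificates
  Literature.NumberTheory.EllipticCurves.KrizLi2019 Literature.NumberTheory.GaloisRepresentations Literature.NumberTheory.QuadraticFields Literature.NumberTheory.QuadraticFields.Quadratic
  Summit.BirchSwinnertonDyer.BirchSwinnertonDyer.Rank1Residual Summit.BirchSwinnertonDyer.BirchSwinnertonDyer.Rank1Residual.IntModel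
  Summit.BirchSwinnertonDyer.BirchSwinnertonDyer.Rank2Observatory.Tam Summit.BirchSwinnertonDyer.Rank1Residual Summit.BirchSwinnertonDyer.Rank1Residual.Additive
  Summit.BirchSwinnertonDyer.Rank1Residual.X11b Summit.BirchSwinnertonDyer.Rank1Residual.X11b.Three Summit.BirchSwinnertonDyer.Rank1Residual.X9 Summit.BirchSwinnertonDyer.Rank1Residual.GaloisImage
  Summit.BirchSwinnertonDyer.Rank1Residual.Supersingular Summit.BirchSwinnertonDyer.BirchSwinnertonDyer.Theses.RamifiedHeegnerPair Summit.BirchSwinnertonDyer.BirchSwinnertonDyer.Theorems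
  Summit.BirchSwinnertonDyer.BirchSwinnertonDyer.Theorems.SchneiderFree Summit.BirchSwinnertonDyer.BirchSwinnertonDyer.Theorems.RamifiedPairUpperBound
  Summit.BirchSwinnertonDyer.BirchSwinnertonDyer.Theorems.RamifiedHeegnerPairStepLIntrinsic Summit.BirchSwinnertonDyer.BirchSwinnertonDyer.Theorems.AdditiveBranchIMCGordTwoRankOne.HeegnerKolyvagin
  Summit.BirchSwinnertonDyer.BirchSwinnertonDyer.Theorems.RamifiedHeegnerPairTwistUnitIntrinsic Summit.BirchSwinnertonDyer.BirchSwinnertonDyer.Theorems.RamifiedHeegnerPairTwistUnitAdditive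
  Summit.BirchSwinnertonDyer.BirchSwinnertonDyer.Theorems.RamifiedHeegnerPairTwistUnitInert

namespace Summit.BirchSwinnertonDyer.BirchSwinnertonDyer.Theorems.RamifiedHeegnerPairTwistUnitSaving

open RamifiedHeegnerPairTwistUnitInert

/-! ## §11 `217854bo1` = `[1, -1, 1, 82384, -86854337]`, `N = 217854 = 2·3^2·7^2·13·19` (`2`: I2, `c = 2`, split, `3`: I₀*, `c = 2`, `7`: IV*, `c = 3`, `13`: I4, `c = 2`, non-split, `19`: I3, `c = 3`, split); exempted carrier `q₁ = 7` (additive IV*, `c = 3`), inert set `S = {2, 19}` (multiplicative), (DEG) très ramifié at `s₁ = 2` (`3 ∤ ord_{2} Δ = 2`);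
`ρ̄₃` onto (certificate primes `ℓ₁ = 11`, `#Ẽ(𝔽_{11}) = 7`; `ℓ₂ = 67`, `#Ẽ(𝔽_{67}) = 66`); `r_an = 0`, `#E(ℚ)_tors = 1`, `∏ c_ℓ = 72`, `#Ш(E)_an = 1` (Cremona/LMFDB, displayed where used); class `217854bo` of size 1.
`V = E^{(-3)}_min = [1, -1, 0, 9154, 3213776]` (`#Ṽ(𝔽₃) = 4`).  JSW field `K = ℚ(√-131)` (`131` prime; `2`, `19` inert, every other `ℓ ∣ N` split): the least such `D` (among those tried) with a CERTIFIED twist unit (kit j322551: root no. `−1`, `L′(Wd,1) = 35.155101`, `Wd = E^{(-131)}_min = [1, -1, 0, 1413797187, 195209797416353]`, `N(Wd) = 3738592494`, `∏c = 96`, `T = 1`, point by `ellrank(effort=0)`, eclib-full saturation (index 1), `ĥ = 21.926023`,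
`X = L′T²/(Ω∏c ĥ) = 1` to `0e+00` — the numerical `#Ш(Wd)_an` given rank `1`). -/

/-- `V = [1, -1, 0, 9154, 3213776]` (the minimal model of `217854bo1^{(-3)}`, conductor `24206`): `Δ ≠ 0` in the kernel. [cite: Cremona2006, Table 1 (Cremona label 217854bo1)] -/
theorem isElliptic_sV217854bo1 : (⟨1, -1, 0, 9154, 3213776⟩ : WeierstrassCurve ℚ).IsElliptic :=
  isElliptic_of_discOf_ne_zero 1 (-1) 0 9154 3213776 (by decide +kernel)

/-- `V` is globally minimal: `|Δ| = 2^2·7^8·13^4·19^3` kernel-checked, Kraus' criterion prime by prime. [cite: Kraus1989, Prop. 1 and Prop. 2]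
[cite: SilvermanAEC2009, VII.1 Remark 1.1] [cite: Cremona2006, Table 1 (Cremona label 217854bo1)] -/
theorem isGloballyMinimal_sV217854bo1 : (⟨1, -1, 0, 9154, 3213776⟩ : WeierstrassCurve ℚ).IsGloballyMinimal :=
  isGloballyMinimal_of_krausCriterion₃_factored 1 (-1) 0 9154 3213776
    [(2, 2), (7, 8), (13, 4), (19, 3)] (by decide +kernel)
    (by intro qe hqe; simp only [List.mem_cons, List.not_mem_nil, or_false] at hqe
        rcases hqe with rfl | rfl | rfl | rfl <;> norm_num)
    (by set_option synthInstance.maxSize 2000 in decide +kernel)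

/-- `Wd = [1, -1, 0, 1413797187, 195209797416353]` (the minimal model of the twist `217854bo1^{(-131)}`, conductor `3738592494`): `Δ ≠ 0` in the kernel. [cite: Cremona2006, Table 1 (Cremona label 217854bo1)] -/
theorem isElliptic_sWd217854bo1 : (⟨1, -1, 0, 1413797187, 195209797416353⟩ : WeierstrassCurve ℚ).IsElliptic :=
  isElliptic_of_discOf_ne_zero 1 (-1) 0 1413797187 195209797416353 (by decide +kernel)

/-- `Wd` is globally minimal: `|Δ| = 2^2·3^6·7^8·13^4·19^3·131^6` kernel-checked, Kraus' criterion prime by prime. [cite: Kraus1989, Prop. 1 and Prop. 2]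
[cite: SilvermanAEC2009, VII.1 Remark 1.1] [cite: Cremona2006, Table 1 (Cremona label 217854bo1)] -/
theorem isGloballyMinimal_sWd217854bo1 : (⟨1, -1, 0, 1413797187, 195209797416353⟩ : WeierstrassCurve ℚ).IsGloballyMinimal :=
  isGloballyMinimal_of_krausCriterion₃_factored 1 (-1) 0 1413797187 195209797416353
    [(2, 2), (3, 6), (7, 8), (13, 4), (19, 3), (131, 6)] (by decide +kernel)
    (by intro qe hqe; simp only [List.mem_cons, List.not_mem_nil, or_false] at hqe
        rcases hqe with rfl | rfl | rfl | rfl | rfl | rfl <;> norm_num)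
    (by set_option synthInstance.maxSize 2000 in decide +kernel)

/-- **`217854bo1` is ADDITIVE at `3` and on the cell (G) ∧ ss, IN THE KERNEL**: `3 ∣ Δ`, `3 ∣ c₄`; `C • V^{(-3)} = E` (`[u, r, s, t] = [1, -1, 1/2, 1/2]`) with
`V` globally minimal, `3 ∤ Δ(V)`, `#Ṽ(𝔽₃) = 4` (`a₃(V) = 0`, supersingular), whence `TypeG`, `SubGord`, `SubGss` at `3` (g13's block, unchanged).
[cite: SilvermanAEC2009, VII.5 Prop. 5.1 (a), (c)] [cite: Delbourgo1998, §1.5 (G)] [cite: Cremona2006, Table 1 (Cremona label 217854bo1)] -/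
theorem subGss_three_217854bo1 {W : WeierstrassCurve ℚ} [W.IsElliptic] [W.IsGloballyMinimal] (hWeq : W = (⟨1, -1, 1, 82384, -86854337⟩ : WeierstrassCurve ℚ)) :
    Addv W 3 ∧ SubGss W 3 := by
  subst hWeq
  haveI := isElliptic_sV217854bo1
  haveI := isGloballyMinimal_sV217854bo1
  have hIW : integralModelInt (⟨1, -1, 1, 82384, -86854337⟩ : WeierstrassCurve ℚ) = (⟨1, -1, 1, 82384, -86854337⟩ : WeierstrassCurve ℤ) :=
    integralModelInt_eq_of_map_eq _ (map_mk_int 1 (-1) 1 82384 (-86854337))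
  have hadd : Addv (⟨1, -1, 1, 82384, -86854337⟩ : WeierstrassCurve ℚ) 3 := Additive.addv_of_intModel hIW 3 (by decide +kernel) (by decide +kernel)
  have hIV : integralModelInt (⟨1, -1, 0, 9154, 3213776⟩ : WeierstrassCurve ℚ) = (⟨1, -1, 0, 9154, 3213776⟩ : WeierstrassCurve ℤ) :=
    integralModelInt_eq_of_map_eq _ (map_mk_int 1 (-1) 0 9154 3213776)
  have hcV : Nat.card ((((⟨1, -1, 0, 9154, 3213776⟩ : WeierstrassCurve ℤ)).map (Int.castRingHom (ZMod 3))).toAffine.Point) = 4 := by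
    have h := natCard_point_eq_countPoints 1 (-1) 0 9154 3213776 3 (by norm_num) (by decide +kernel)
    have h' : countPoints [1, -1, 0, 9154, 3213776] 3 = 4 := countPoints_eq_of_fast (by decide +kernel)
    exact_mod_cast h.trans h'
  have hgood : GoodSS (⟨1, -1, 0, 9154, 3213776⟩ : WeierstrassCurve ℚ) 3 := Supersingular.goodSS_of_intModel 3 hIV (by decide +kernel) hcV (by decide)
  have hVW : (⟨1, (-1 : ℚ), ((1:ℚ)/2), ((1:ℚ)/2)⟩ : VariableChange ℚ) • (⟨1, -1, 0, 9154, 3213776⟩ : WeierstrassCurve ℚ).quadraticTwist (-3) =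
      (⟨1, -1, 1, 82384, -86854337⟩ : WeierstrassCurve ℚ) := by
    ext <;> simp [WeierstrassCurve.variableChange_a₁, WeierstrassCurve.variableChange_a₂,
      WeierstrassCurve.variableChange_a₃, WeierstrassCurve.variableChange_a₄, WeierstrassCurve.variableChange_a₆,
      WeierstrassCurve.quadraticTwist, WeierstrassCurve.b₂, WeierstrassCurve.b₄, WeierstrassCurve.b₆] <;> norm_num
  obtain ⟨C, hC⟩ := exists_variableChange_quadraticTwist_symm (⟨1, -1, 1, 82384, -86854337⟩ : WeierstrassCurve ℚ)
    (⟨1, -1, 0, 9154, 3213776⟩ : WeierstrassCurve ℚ) (d := (-3 : ℚ)) (by norm_num) ⟨_, hVW⟩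
  have hC' : C • (⟨1, -1, 1, 82384, -86854337⟩ : WeierstrassCurve ℚ).quadraticTwist ((-1 : ℚ) ^ ((3 : ℕ) / 2) * (3 : ℕ)) =
      (⟨1, -1, 0, 9154, 3213776⟩ : WeierstrassCurve ℚ) := by
    rw [O5.pstar_three]; exact hC
  have hG : TypeG (⟨1, -1, 1, 82384, -86854337⟩ : WeierstrassCurve ℚ) 3 := (typeG_three_iff_good_twist _ hadd _ C hC').mpr hgood.1
  exact ⟨hadd, (O5.subGss_three_iff_subGord_and_goodSS_twist _ hadd _ C hC).mpr
    ⟨subGord_three_of_typeG_of_addv _ hG hadd, hgood⟩⟩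

/-- `Δ(E₀) = -3293108590538268684 = -2^2·3^6·7^8·13^4·19^3` on the integer equation of `217854bo1`. [cite: Cremona2006, Table 1 (Cremona label 217854bo1)] -/
theorem Δ_eq_217854bo1 : (⟨1, -1, 1, 82384, -86854337⟩ : WeierstrassCurve ℤ).Δ = -3293108590538268684 := by
  norm_num [WeierstrassCurve.Δ, WeierstrassCurve.b₂, WeierstrassCurve.b₄, WeierstrassCurve.b₆, WeierstrassCurve.b₈]

/-- `c₄(E₀) = -3954447` on the integer equation of `217854bo1`. [cite: Cremona2006, Table 1 (Cremona label 217854bo1)] -/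
theorem c₄_eq_217854bo1 : (⟨1, -1, 1, 82384, -86854337⟩ : WeierstrassCurve ℤ).c₄ = -3954447 := by
  norm_num [WeierstrassCurve.c₄, WeierstrassCurve.b₂, WeierstrassCurve.b₄]

/-- The Kraus list of `217854bo1` consists of primes and multiplies to `|Δ(E₀)|`, IN THE KERNEL: a prime dividing `Δ_min` is one of `[2, 3, 7, 13, 19]`. [cite: Cremona2006, Table 1 (Cremona label 217854bo1)] -/
theorem krausList_217854bo1 : (∀ qe ∈ ([(2, 2), (3, 6), (7, 8), (13, 4), (19, 3)] : List (ℕ × ℕ)), qe.1.Prime) ∧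
    (([(2, 2), (3, 6), (7, 8), (13, 4), (19, 3)] : List (ℕ × ℕ)).map fun qe => qe.1 ^ qe.2).prod = (-3293108590538268684 : ℤ).natAbs :=
  ⟨by decide +kernel, by decide +kernel⟩

/-- **`ρ̄_{E,3}` ONTO for `217854bo1`, IN THE KERNEL** (Frobenius-order witness `hasSurjectiveModNGaloisRep_of_intModel_of_irr_of_order`): at the good prime `ℓ₁ = 11` (`#Ẽ(𝔽_{11}) = 7`,
`a = 5`) `X² − aX + 11` is irreducible mod `3`; at `ℓ₂ = 67 ≡ 1 (mod 3)` (`#Ẽ = 66`, `a = 2 ≡ 2`, `9 ∤ 66`) an element of order `3`; point counts by `countPoints_eq_of_fast`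
(Sage's `is_surjective(3)` agrees). [cite: Serre1972, §2.8 Prop. 19] [cite: Zywina2015, §1] [cite: Cremona2006, Table 1 (Cremona label 217854bo1)] -/
theorem surj_three_217854bo1 {W : WeierstrassCurve ℚ} [W.IsElliptic] [W.IsGloballyMinimal] (hWeq : W = (⟨1, -1, 1, 82384, -86854337⟩ : WeierstrassCurve ℚ)) : Surj W 3 := by
  subst hWeq
  haveI : Fact (Nat.Prime 11) := ⟨by norm_num⟩
  haveI : Fact (Nat.Prime 67) := ⟨by norm_num⟩
  have hI : integralModelInt (⟨1, -1, 1, 82384, -86854337⟩ : WeierstrassCurve ℚ) = (⟨1, -1, 1, 82384, -86854337⟩ : WeierstrassCurve ℤ) :=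
    integralModelInt_eq_of_map_eq _ (map_mk_int 1 (-1) 1 82384 (-86854337))
  have hc₁ : Nat.card ((((⟨1, -1, 1, 82384, -86854337⟩ : WeierstrassCurve ℤ)).map (Int.castRingHom (ZMod 11))).toAffine.Point) = 7 := by
    exact_mod_cast (natCard_point_eq_countPoints 1 (-1) 1 82384 (-86854337) 11 (by norm_num) (by decide +kernel)).trans (countPoints_eq_of_fast (n := 7) (by decide +kernel))
  have hc₂ : Nat.card ((((⟨1, -1, 1, 82384, -86854337⟩ : WeierstrassCurve ℤ)).map (Int.castRingHom (ZMod 67))).toAffine.Point) = 66 := by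
    exact_mod_cast (natCard_point_eq_countPoints 1 (-1) 1 82384 (-86854337) 67 (by norm_num) (by decide +kernel)).trans (countPoints_eq_of_fast (n := 66) (by decide +kernel))
  exact hasSurjectiveModNGaloisRep_of_intModel_of_irr_of_order hI 3 11 67 (by norm_num) (by norm_num) (by rw [Δ_eq_217854bo1]; norm_num)
    (by rw [Δ_eq_217854bo1]; norm_num) hc₁ hc₂ (by decide) (by decide) (by decide) (by decide)

/-- **U₀ AT `217854bo1` ON ITS SAVING ROW (inert-set Shimura-curve road, TU₀|saving)** — `MissingUpperBoundAt W 3` at `W = E` (`r_an = 0`) from rhp-p2 g11's shape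
p674548 `leafRankZeroUpper_three_of_shimuraInertDatum_at_saving_of_twistUnitZero` through the door `leafRankZeroUpper_three_at_saving_of_sqrtField`.  PRINTED: `hGZK hmod hnf hJL hCO hPrim`.  KERNEL: `Addv ∧ SubGss` at `3`; `ρ̄₃` onto;
`q₁ = 7 ∣ Δ_min`; `2`, `19` multiplicative; every prime of `Δ_min` enumerated (`krausList_217854bo1`) for `hFC` and for `hshape` off `q₁` (`c = 1` off `Δ_min`, Kodaira–Néron at multiplicative
primes, Tate certificates at the additive primes `[3]`); (DEG) très ramifié at `s₁ = 2`; the congruences making `2`, `19` inert and the other `ℓ ∣ N` split in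
`ℚ(√-131)`; `Cd • E^{(-131)} = Wd`, `Cd = [1, -33, 1/2, 0]`, `Wd` Kraus-minimal.  DISPLAYED: `hN`, `hr` (`r_an = 0`), `Dt`/`hc`, `hLt0`/`hLt1` (`L(E^{(-131)},1) = 0 ≠ L′`; census: root no. `−1`,
`L′(Wd,1) ≈ 35.15510`), `hqd`/`hvd` (`#Ш(Wd)_an = 1`; census: `X = L′T²/(Ω∏c ĥ) = 1` to `0e+00`, eclib-full-saturated point of height `21.9260` by `ellrank(effort=0)`, 2-descent rank `1`).
NO S2 / Σ / L₀ / L₁.  Per curve; U₀ (26024) stays OPEN class-wide; BSD is NOT proved by this.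
[cite: JetchevSkinnerWan2017, §7.4.2 (p. 31)] [cite: PastenShimura2024, Prop. 6.13, Lemma 6.15, Lemma 6.18] [cite: SilvermanAEC2009, VII.5 Prop. 5.1] [cite: Cremona2006, Table 1 (Cremona label 217854bo1)] -/
theorem u0s_at_217854bo1
    (hGZK : rank_eq_analyticRank_of_analyticRank_le_one) (hmod : hasEntireLFunction_rat)
    (hnf : exists_isNewformOf) (hJL : nonempty_shimuraParametrizationData)
    (hCO : PastenShimura2024_componentOrders) (hPrim : shimuraCurve_heegnerSystem_primitivesAtThree)
    {W : WeierstrassCurve ℚ} [W.IsElliptic] [W.IsGloballyMinimal] (hWeq : W = (⟨1, -1, 1, 82384, -86854337⟩ : WeierstrassCurve ℚ))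
    (hN : W.conductorNorm ℤ = 217854) [NeZero (W.conductorNorm ℤ)] (hr : W.analyticRank = 0)
    (Dt : ModularParametrizationData W (W.conductorNorm ℤ)) (hc : ¬ (3 : ℤ) ∣ Dt.c)
    (hLt0 : (W.quadraticTwist (((-131 : ℤ) : ℚ))).entireLFunction 1 = 0) (hLt1 : deriv (W.quadraticTwist (((-131 : ℤ) : ℚ))).entireLFunction 1 ≠ 0)
    {qd : ℚ} (hqd : haveI := isElliptic_sWd217854bo1; shaAn (⟨1, -1, 0, 1413797187, 195209797416353⟩ : WeierstrassCurve ℚ) = (qd : ℂ))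
    (hvd : padicValRat 3 qd ≤ 0) :
    MissingUpperBoundAt W 3 := by
  subst hWeq
  haveI := isElliptic_sWd217854bo1; haveI := isGloballyMinimal_sWd217854bo1
  have hI : integralModelInt (⟨1, -1, 1, 82384, -86854337⟩ : WeierstrassCurve ℚ) = (⟨1, -1, 1, 82384, -86854337⟩ : WeierstrassCurve ℤ) :=
    integralModelInt_eq_of_map_eq _ (map_mk_int 1 (-1) 1 82384 (-86854337))
  have hGS := subGss_three_217854bo1 (W := (⟨1, -1, 1, 82384, -86854337⟩ : WeierstrassCurve ℚ)) rfl
  have hsurj := surj_three_217854bo1 (W := (⟨1, -1, 1, 82384, -86854337⟩ : WeierstrassCurve ℚ)) rfl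
  haveI : Fact ((-131 : ℤ) < 0) := ⟨by norm_num⟩; haveI : Fact (Nat.Prime 7) := ⟨by norm_num⟩
  haveI : Fact (Nat.Prime 2) := ⟨by norm_num⟩; haveI : Fact (Nat.Prime 19) := ⟨by norm_num⟩
  have hbad₁ := WeierstrassCurve.not_hasGoodReductionAtPrime_of_dvd_minimalDiscriminantInt (⟨1, -1, 1, 82384, -86854337⟩ : WeierstrassCurve ℚ) 7 (by rw [IntModel.minimalDiscriminantInt_eq hI, Δ_eq_217854bo1]; norm_num)
  have hm₁ : (⟨1, -1, 1, 82384, -86854337⟩ : WeierstrassCurve ℚ).HasMultiplicativeReductionAtPrime 2 := IntModel.hasMultiplicativeReductionAtPrime_of_intModel hI 2 (by rw [Δ_eq_217854bo1]; norm_num) (by rw [c₄_eq_217854bo1]; norm_num)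
  have hm₂ : (⟨1, -1, 1, 82384, -86854337⟩ : WeierstrassCurve ℚ).HasMultiplicativeReductionAtPrime 19 := IntModel.hasMultiplicativeReductionAtPrime_of_intModel hI 19 (by rw [Δ_eq_217854bo1]; norm_num) (by rw [c₄_eq_217854bo1]; norm_num)
  have hFC : ∀ (ℓ : ℕ) [Fact ℓ.Prime], ℓ ≠ 2 → ℓ ≠ 19 → ℓ ≠ 7 → (⟨1, -1, 1, 82384, -86854337⟩ : WeierstrassCurve ℚ).HasSplitMultiplicativeReductionAtPrime ℓ →
      ¬ 3 ∣ padicValInt ℓ (⟨1, -1, 1, 82384, -86854337⟩ : WeierstrassCurve ℚ).minimalDiscriminantInt := by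
    intro ℓ hℓF hne₁ hne₂ hneq hs
    have hd := dvd_minimalDiscriminantInt_of_mult _ ℓ hs.hasMultiplicativeReductionAtPrime
    rw [IntModel.minimalDiscriminantInt_eq hI, Δ_eq_217854bo1] at hd
    have hmem := mem_of_prime_dvd_of_prodPow_eq _ krausList_217854bo1 hℓF.out hd
    simp only [List.map_cons, List.map_nil, List.mem_cons, List.not_mem_nil, or_false] at hmem
    rcases hmem with rfl | rfl | rfl | rfl | rfl
    · exact absurd rfl hne₁
    · exact absurd hs.hasMultiplicativeReductionAtPrime (X9.PrintCert.not_hasMultiplicativeReductionAtPrime_of_dvd_of_dvd hI 3 (by rw [Δ_eq_217854bo1]; norm_num) (by rw [c₄_eq_217854bo1]; norm_num))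
    · exact absurd rfl hneq
    · rw [IntModel.minimalDiscriminantInt_eq hI, Δ_eq_217854bo1, IntModel.padicValInt_eq_of_dvd_of_not_dvd 13 (e := 4) (by norm_num) (by norm_num)]
      decide
    · exact absurd rfl hne₂
  have hshape : ∀ (q : ℕ) [Fact q.Prime], q ≠ 7 → 3 ∣ ((⟨1, -1, 1, 82384, -86854337⟩ : WeierstrassCurve ℚ).baseChange ℚ_[q]).localTamagawaNumber ℤ_[q] →
      (⟨1, -1, 1, 82384, -86854337⟩ : WeierstrassCurve ℚ).HasSplitMultiplicativeReductionAtPrime q := by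
    intro q hqF hq h3
    by_cases hd : (q : ℤ) ∣ minimalDiscriminantInt (⟨1, -1, 1, 82384, -86854337⟩ : WeierstrassCurve ℚ)
    swap
    · exact absurd h3 (not_three_dvd_localTamagawaNumber_of_not_dvd _ q hd)
    rw [IntModel.minimalDiscriminantInt_eq hI, Δ_eq_217854bo1] at hd
    have hmem := mem_of_prime_dvd_of_prodPow_eq _ krausList_217854bo1 hqF.out hd
    simp only [List.map_cons, List.map_nil, List.mem_cons, List.not_mem_nil, or_false] at hmem
    rcases hmem with rfl | rfl | rfl | rfl | rfl
    · exact (Koly.split_and_three_dvd_of_mult_of_three_dvd_localTamagawaNumber _ 2 (IntModel.hasMultiplicativeReductionAtPrime_of_intModel hI 2 (by rw [Δ_eq_217854bo1]; norm_num) (by rw [c₄_eq_217854bo1]; norm_num)) h3).1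
    · have hc3 : ((⟨1, -1, 1, 82384, -86854337⟩ : WeierstrassCurve ℚ).baseChange ℚ_[3]).localTamagawaNumber ℤ_[3] = 2 := -- additive `3` (I0*): Tate certificate
        (IntModelTam.localTamagawaNumber_padic_eq_of_intModel_of_tamZ hI 3 (F := ⟨3, 9, 1, 1, 8, 6, 0, 1⟩) rfl (by decide +kernel)).trans (by decide)
      rw [hc3] at h3; exact absurd h3 (by decide)
    · exact absurd rfl hq
    · exact (Koly.split_and_three_dvd_of_mult_of_three_dvd_localTamagawaNumber _ 13 (IntModel.hasMultiplicativeReductionAtPrime_of_intModel hI 13 (by rw [Δ_eq_217854bo1]; norm_num) (by rw [c₄_eq_217854bo1]; norm_num)) h3).1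
    · exact (Koly.split_and_three_dvd_of_mult_of_three_dvd_localTamagawaNumber _ 19 (IntModel.hasMultiplicativeReductionAtPrime_of_intModel hI 19 (by rw [Δ_eq_217854bo1]; norm_num) (by rw [c₄_eq_217854bo1]; norm_num)) h3).1
  have hjac : ∀ ℓ : ℕ, ℓ.Prime → ℓ ∣ (⟨1, -1, 1, 82384, -86854337⟩ : WeierstrassCurve ℚ).conductorNorm ℤ → ℓ ≠ 2 → ℓ ≠ 19 → ℓ ≠ 2 →
      jacobiSym (-131) ℓ = 1 := by
    intro ℓ hℓ hℓN hne₁ hne₂ hℓ2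
    rw [hN] at hℓN
    have hmem : ℓ ∈ Nat.primeFactors 217854 := Nat.mem_primeFactors.mpr ⟨hℓ, hℓN, by norm_num⟩
    rw [show Nat.primeFactors 217854 = {2, 3, 7, 13, 19} by decide +kernel] at hmem
    simp only [Finset.mem_insert, Finset.mem_singleton] at hmem
    rcases hmem with rfl | rfl | rfl | rfl | rfl
    · exact absurd rfl hne₁
    · norm_num [jacobiSym.mod_left]
    · norm_num [jacobiSym.mod_left]
    · norm_num [jacobiSym.mod_left]
    · exact absurd rfl hne₂
  have hWd : (⟨1, (-33 : ℚ), ((1:ℚ)/2), (0 : ℚ)⟩ : VariableChange ℚ) • (⟨1, -1, 1, 82384, -86854337⟩ : WeierstrassCurve ℚ).quadraticTwist (((-131 : ℤ) : ℚ)) =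
      (⟨1, -1, 0, 1413797187, 195209797416353⟩ : WeierstrassCurve ℚ) := by
    push_cast; ext <;> simp [WeierstrassCurve.variableChange_a₁, WeierstrassCurve.variableChange_a₂,
      WeierstrassCurve.variableChange_a₃, WeierstrassCurve.variableChange_a₄, WeierstrassCurve.variableChange_a₆,
      WeierstrassCurve.quadraticTwist, WeierstrassCurve.b₂, WeierstrassCurve.b₄, WeierstrassCurve.b₆] <;> norm_num
  exact leafRankZeroUpper_three_at_saving_of_sqrtField hGZK hmod hnf hJL hCO hPrim _ hGS.1 hGS.2 hr hsurj rfl Dt hc 7 hbad₁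
    (s₁ := 2) (s₂ := 19) (by decide) (by decide) (by decide) hm₁ hm₂ hFC hshape
    (Or.inl (by rw [IntModel.minimalDiscriminantInt_eq hI, Δ_eq_217854bo1, IntModel.padicValInt_eq_of_dvd_of_not_dvd 2 (e := 2) (by norm_num) (by norm_num)]; decide))
    (-131) (by norm_num) (by rw [show (-131 : ℤ).natAbs = 131 by rfl, Nat.squarefree_iff_nodup_primeFactorsList (by norm_num)]; simp)
    (Or.inl ⟨rfl, by norm_num⟩) (by norm_num) (Or.inr ⟨by decide, by norm_num [jacobiSym.mod_left]⟩) (by norm_num) hjac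
    (fun _ h _ ↦ absurd rfl h) hLt0 hLt1 _ _ hWd hqd hvd

/-! ## §12 `242550ot1` = `[1, -1, 1, -62705, -4795703]`, `N = 242550 = 2·3^2·5^2·7^2·11` (`2`: I3, `c = 3`, split, `3`: I₀*, `c = 1`, `5`: I₀*, `c = 2`, `7`: IV*, `c = 3`, `11`: I1, `c = 1`, split); exempted carrier `q₁ = 7` (additive IV*, `c = 3`), inert set `S = {11, 2}` (multiplicative), (DEG) très ramifié at `s₁ = 11` (`3 ∤ ord_{11} Δ = 1`);
`ρ̄₃` onto (certificate primes `ℓ₁ = 17`, `#Ẽ(𝔽_{17}) = 16`; `ℓ₂ = 37`, `#Ẽ(𝔽_{37}) = 42`); `r_an = 0`, `#E(ℚ)_tors = 1`, `∏ c_ℓ = 18`, `#Ш(E)_an = 1` (Cremona/LMFDB, displayed where used); class `242550ot` of size 1.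
`V = E^{(-3)}_min = [1, -1, 0, -6967, 179941]` (`#Ṽ(𝔽₃) = 7`).  JSW field `K = ℚ(√-59)` (`59` prime; `11`, `2` inert, every other `ℓ ∣ N` split): the least such `D` (among those tried) with a CERTIFIED twist unit (kit j322551: root no. `−1`, `L′(Wd,1) = 11.198465`, `Wd = E^{(-59)}_min = [1, -1, 0, -218275017, 988210757141]`, `N(Wd) = 844316550`, `∏c = 6`, `T = 1`, point by `ellrank(effort=0)`, eclib-full saturation (index 1), `ĥ = 35.549216`,
`X = L′T²/(Ω∏c ĥ) = 1` to `2e-16` — the numerical `#Ш(Wd)_an` given rank `1`). -/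

/-- `V = [1, -1, 0, -6967, 179941]` (the minimal model of `242550ot1^{(-3)}`, conductor `26950`): `Δ ≠ 0` in the kernel. [cite: Cremona2006, Table 1 (Cremona label 242550ot1)] -/
theorem isElliptic_sV242550ot1 : (⟨1, -1, 0, -6967, 179941⟩ : WeierstrassCurve ℚ).IsElliptic :=
  isElliptic_of_discOf_ne_zero 1 (-1) 0 (-6967) 179941 (by decide +kernel)

/-- `V` is globally minimal: `|Δ| = 2^3·5^6·7^8·11` kernel-checked, Kraus' criterion prime by prime. [cite: Kraus1989, Prop. 1 and Prop. 2]
[cite: SilvermanAEC2009, VII.1 Remark 1.1] [cite: Cremona2006, Table 1 (Cremona label 242550ot1)] -/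
theorem isGloballyMinimal_sV242550ot1 : (⟨1, -1, 0, -6967, 179941⟩ : WeierstrassCurve ℚ).IsGloballyMinimal :=
  isGloballyMinimal_of_krausCriterion₃_factored 1 (-1) 0 (-6967) 179941
    [(2, 3), (5, 6), (7, 8), (11, 1)] (by decide +kernel)
    (by intro qe hqe; simp only [List.mem_cons, List.not_mem_nil, or_false] at hqe
        rcases hqe with rfl | rfl | rfl | rfl <;> norm_num)
    (by set_option synthInstance.maxSize 2000 in decide +kernel)

/-- `Wd = [1, -1, 0, -218275017, 988210757141]` (the minimal model of the twist `242550ot1^{(-59)}`, conductor `844316550`): `Δ ≠ 0` in the kernel. [cite: Cremona2006, Table 1 (Cremona label 242550ot1)] -/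
theorem isElliptic_sWd242550ot1 : (⟨1, -1, 0, -218275017, 988210757141⟩ : WeierstrassCurve ℚ).IsElliptic :=
  isElliptic_of_discOf_ne_zero 1 (-1) 0 (-218275017) 988210757141 (by decide +kernel)

/-- `Wd` is globally minimal: `|Δ| = 2^3·3^6·5^6·7^8·11·59^6` kernel-checked, Kraus' criterion prime by prime. [cite: Kraus1989, Prop. 1 and Prop. 2]
[cite: SilvermanAEC2009, VII.1 Remark 1.1] [cite: Cremona2006, Table 1 (Cremona label 242550ot1)] -/
theorem isGloballyMinimal_sWd242550ot1 : (⟨1, -1, 0, -218275017, 988210757141⟩ : WeierstrassCurve ℚ).IsGloballyMinimal :=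
  isGloballyMinimal_of_krausCriterion₃_factored 1 (-1) 0 (-218275017) 988210757141
    [(2, 3), (3, 6), (5, 6), (7, 8), (11, 1), (59, 6)] (by decide +kernel)
    (by intro qe hqe; simp only [List.mem_cons, List.not_mem_nil, or_false] at hqe
        rcases hqe with rfl | rfl | rfl | rfl | rfl | rfl <;> norm_num)
    (by set_option synthInstance.maxSize 2000 in decide +kernel)

/-- **`242550ot1` is ADDITIVE at `3` and on the cell (G) ∧ ss, IN THE KERNEL**: `3 ∣ Δ`, `3 ∣ c₄`; `C • V^{(-3)} = E` (`[u, r, s, t] = [1, -1, 1/2, 1/2]`) with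
`V` globally minimal, `3 ∤ Δ(V)`, `#Ṽ(𝔽₃) = 7` (`a₃(V) = -3`, supersingular), whence `TypeG`, `SubGord`, `SubGss` at `3` (g13's block, unchanged).
[cite: SilvermanAEC2009, VII.5 Prop. 5.1 (a), (c)] [cite: Delbourgo1998, §1.5 (G)] [cite: Cremona2006, Table 1 (Cremona label 242550ot1)] -/
theorem subGss_three_242550ot1 {W : WeierstrassCurve ℚ} [W.IsElliptic] [W.IsGloballyMinimal] (hWeq : W = (⟨1, -1, 1, -62705, -4795703⟩ : WeierstrassCurve ℚ)) :
    Addv W 3 ∧ SubGss W 3 := by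
  subst hWeq
  haveI := isElliptic_sV242550ot1
  haveI := isGloballyMinimal_sV242550ot1
  have hIW : integralModelInt (⟨1, -1, 1, -62705, -4795703⟩ : WeierstrassCurve ℚ) = (⟨1, -1, 1, -62705, -4795703⟩ : WeierstrassCurve ℤ) :=
    integralModelInt_eq_of_map_eq _ (map_mk_int 1 (-1) 1 (-62705) (-4795703))
  have hadd : Addv (⟨1, -1, 1, -62705, -4795703⟩ : WeierstrassCurve ℚ) 3 := Additive.addv_of_intModel hIW 3 (by decide +kernel) (by decide +kernel)
  have hIV : integralModelInt (⟨1, -1, 0, -6967, 179941⟩ : WeierstrassCurve ℚ) = (⟨1, -1, 0, -6967, 179941⟩ : WeierstrassCurve ℤ) :=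
    integralModelInt_eq_of_map_eq _ (map_mk_int 1 (-1) 0 (-6967) 179941)
  have hcV : Nat.card ((((⟨1, -1, 0, -6967, 179941⟩ : WeierstrassCurve ℤ)).map (Int.castRingHom (ZMod 3))).toAffine.Point) = 7 := by
    have h := natCard_point_eq_countPoints 1 (-1) 0 (-6967) 179941 3 (by norm_num) (by decide +kernel)
    have h' : countPoints [1, -1, 0, -6967, 179941] 3 = 7 := countPoints_eq_of_fast (by decide +kernel)
    exact_mod_cast h.trans h'
  have hgood : GoodSS (⟨1, -1, 0, -6967, 179941⟩ : WeierstrassCurve ℚ) 3 := Supersingular.goodSS_of_intModel 3 hIV (by decide +kernel) hcV (by decide)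
  have hVW : (⟨1, (-1 : ℚ), ((1:ℚ)/2), ((1:ℚ)/2)⟩ : VariableChange ℚ) • (⟨1, -1, 0, -6967, 179941⟩ : WeierstrassCurve ℚ).quadraticTwist (-3) =
      (⟨1, -1, 1, -62705, -4795703⟩ : WeierstrassCurve ℚ) := by
    ext <;> simp [WeierstrassCurve.variableChange_a₁, WeierstrassCurve.variableChange_a₂,
      WeierstrassCurve.variableChange_a₃, WeierstrassCurve.variableChange_a₄, WeierstrassCurve.variableChange_a₆,
      WeierstrassCurve.quadraticTwist, WeierstrassCurve.b₂, WeierstrassCurve.b₄, WeierstrassCurve.b₆] <;> norm_num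
  obtain ⟨C, hC⟩ := exists_variableChange_quadraticTwist_symm (⟨1, -1, 1, -62705, -4795703⟩ : WeierstrassCurve ℚ)
    (⟨1, -1, 0, -6967, 179941⟩ : WeierstrassCurve ℚ) (d := (-3 : ℚ)) (by norm_num) ⟨_, hVW⟩
  have hC' : C • (⟨1, -1, 1, -62705, -4795703⟩ : WeierstrassCurve ℚ).quadraticTwist ((-1 : ℚ) ^ ((3 : ℕ) / 2) * (3 : ℕ)) =
      (⟨1, -1, 0, -6967, 179941⟩ : WeierstrassCurve ℚ) := by
    rw [O5.pstar_three]; exact hC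
  have hG : TypeG (⟨1, -1, 1, -62705, -4795703⟩ : WeierstrassCurve ℚ) 3 := (typeG_three_iff_good_twist _ hadd _ C hC').mpr hgood.1
  exact ⟨hadd, (O5.subGss_three_iff_subGord_and_goodSS_twist _ hadd _ C hC).mpr
    ⟨subGord_three_of_typeG_of_addv _ hG hadd, hgood⟩⟩

/-- `Δ(E₀) = 5778492402375000 = 2^3·3^6·5^6·7^8·11` on the integer equation of `242550ot1`. [cite: Cremona2006, Table 1 (Cremona label 242550ot1)] -/
theorem Δ_eq_242550ot1 : (⟨1, -1, 1, -62705, -4795703⟩ : WeierstrassCurve ℤ).Δ = 5778492402375000 := by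
  norm_num [WeierstrassCurve.Δ, WeierstrassCurve.b₂, WeierstrassCurve.b₄, WeierstrassCurve.b₆, WeierstrassCurve.b₈]

/-- `c₄(E₀) = 3009825` on the integer equation of `242550ot1`. [cite: Cremona2006, Table 1 (Cremona label 242550ot1)] -/
theorem c₄_eq_242550ot1 : (⟨1, -1, 1, -62705, -4795703⟩ : WeierstrassCurve ℤ).c₄ = 3009825 := by
  norm_num [WeierstrassCurve.c₄, WeierstrassCurve.b₂, WeierstrassCurve.b₄]

/-- The Kraus list of `242550ot1` consists of primes and multiplies to `|Δ(E₀)|`, IN THE KERNEL: a prime dividing `Δ_min` is one of `[2, 3, 5, 7, 11]`. [cite: Cremona2006, Table 1 (Cremona label 242550ot1)] -/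
theorem krausList_242550ot1 : (∀ qe ∈ ([(2, 3), (3, 6), (5, 6), (7, 8), (11, 1)] : List (ℕ × ℕ)), qe.1.Prime) ∧
    (([(2, 3), (3, 6), (5, 6), (7, 8), (11, 1)] : List (ℕ × ℕ)).map fun qe => qe.1 ^ qe.2).prod = (5778492402375000 : ℤ).natAbs :=
  ⟨by decide +kernel, by decide +kernel⟩

/-- **`ρ̄_{E,3}` ONTO for `242550ot1`, IN THE KERNEL** (Frobenius-order witness `hasSurjectiveModNGaloisRep_of_intModel_of_irr_of_order`): at the good prime `ℓ₁ = 17` (`#Ẽ(𝔽_{17}) = 16`,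
`a = 2`) `X² − aX + 17` is irreducible mod `3`; at `ℓ₂ = 37 ≡ 1 (mod 3)` (`#Ẽ = 42`, `a = -4 ≡ 2`, `9 ∤ 42`) an element of order `3`; point counts by `countPoints_eq_of_fast`
(Sage's `is_surjective(3)` agrees). [cite: Serre1972, §2.8 Prop. 19] [cite: Zywina2015, §1] [cite: Cremona2006, Table 1 (Cremona label 242550ot1)] -/
theorem surj_three_242550ot1 {W : WeierstrassCurve ℚ} [W.IsElliptic] [W.IsGloballyMinimal] (hWeq : W = (⟨1, -1, 1, -62705, -4795703⟩ : WeierstrassCurve ℚ)) : Surj W 3 := by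
  subst hWeq
  haveI : Fact (Nat.Prime 17) := ⟨by norm_num⟩
  haveI : Fact (Nat.Prime 37) := ⟨by norm_num⟩
  have hI : integralModelInt (⟨1, -1, 1, -62705, -4795703⟩ : WeierstrassCurve ℚ) = (⟨1, -1, 1, -62705, -4795703⟩ : WeierstrassCurve ℤ) :=
    integralModelInt_eq_of_map_eq _ (map_mk_int 1 (-1) 1 (-62705) (-4795703))
  have hc₁ : Nat.card ((((⟨1, -1, 1, -62705, -4795703⟩ : WeierstrassCurve ℤ)).map (Int.castRingHom (ZMod 17))).toAffine.Point) = 16 := by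
    exact_mod_cast (natCard_point_eq_countPoints 1 (-1) 1 (-62705) (-4795703) 17 (by norm_num) (by decide +kernel)).trans (countPoints_eq_of_fast (n := 16) (by decide +kernel))
  have hc₂ : Nat.card ((((⟨1, -1, 1, -62705, -4795703⟩ : WeierstrassCurve ℤ)).map (Int.castRingHom (ZMod 37))).toAffine.Point) = 42 := by
    exact_mod_cast (natCard_point_eq_countPoints 1 (-1) 1 (-62705) (-4795703) 37 (by norm_num) (by decide +kernel)).trans (countPoints_eq_of_fast (n := 42) (by decide +kernel))
  exact hasSurjectiveModNGaloisRep_of_intModel_of_irr_of_order hI 3 17 37 (by norm_num) (by norm_num) (by rw [Δ_eq_242550ot1]; norm_num)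
    (by rw [Δ_eq_242550ot1]; norm_num) hc₁ hc₂ (by decide) (by decide) (by decide) (by decide)

/-- **U₀ AT `242550ot1` ON ITS SAVING ROW (inert-set Shimura-curve road, TU₀|saving)** — `MissingUpperBoundAt W 3` at `W = E` (`r_an = 0`) from rhp-p2 g11's shape
p674548 `leafRankZeroUpper_three_of_shimuraInertDatum_at_saving_of_twistUnitZero` through the door `leafRankZeroUpper_three_at_saving_of_sqrtField`.  PRINTED: `hGZK hmod hnf hJL hCO hPrim`.  KERNEL: `Addv ∧ SubGss` at `3`; `ρ̄₃` onto;
`q₁ = 7 ∣ Δ_min`; `11`, `2` multiplicative; every prime of `Δ_min` enumerated (`krausList_242550ot1`) for `hFC` and for `hshape` off `q₁` (`c = 1` off `Δ_min`, Kodaira–Néron at multiplicative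
primes, Tate certificates at the additive primes `[3, 5]`); (DEG) très ramifié at `s₁ = 11`; the congruences making `11`, `2` inert and the other `ℓ ∣ N` split in
`ℚ(√-59)`; `Cd • E^{(-59)} = Wd`, `Cd = [1, -15, 1/2, 0]`, `Wd` Kraus-minimal.  DISPLAYED: `hN`, `hr` (`r_an = 0`), `Dt`/`hc`, `hLt0`/`hLt1` (`L(E^{(-59)},1) = 0 ≠ L′`; census: root no. `−1`,
`L′(Wd,1) ≈ 11.19846`), `hqd`/`hvd` (`#Ш(Wd)_an = 1`; census: `X = L′T²/(Ω∏c ĥ) = 1` to `2e-16`, eclib-full-saturated point of height `35.5492` by `ellrank(effort=0)`, 2-descent rank `1`).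
NO S2 / Σ / L₀ / L₁.  Per curve; U₀ (26024) stays OPEN class-wide; BSD is NOT proved by this.
[cite: JetchevSkinnerWan2017, §7.4.2 (p. 31)] [cite: PastenShimura2024, Prop. 6.13, Lemma 6.15, Lemma 6.18] [cite: SilvermanAEC2009, VII.5 Prop. 5.1] [cite: Cremona2006, Table 1 (Cremona label 242550ot1)] -/
theorem u0s_at_242550ot1
    (hGZK : rank_eq_analyticRank_of_analyticRank_le_one) (hmod : hasEntireLFunction_rat)
    (hnf : exists_isNewformOf) (hJL : nonempty_shimuraParametrizationData)
    (hCO : PastenShimura2024_componentOrders) (hPrim : shimuraCurve_heegnerSystem_primitivesAtThree)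
    {W : WeierstrassCurve ℚ} [W.IsElliptic] [W.IsGloballyMinimal] (hWeq : W = (⟨1, -1, 1, -62705, -4795703⟩ : WeierstrassCurve ℚ))
    (hN : W.conductorNorm ℤ = 242550) [NeZero (W.conductorNorm ℤ)] (hr : W.analyticRank = 0)
    (Dt : ModularParametrizationData W (W.conductorNorm ℤ)) (hc : ¬ (3 : ℤ) ∣ Dt.c)
    (hLt0 : (W.quadraticTwist (((-59 : ℤ) : ℚ))).entireLFunction 1 = 0) (hLt1 : deriv (W.quadraticTwist (((-59 : ℤ) : ℚ))).entireLFunction 1 ≠ 0)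
    {qd : ℚ} (hqd : haveI := isElliptic_sWd242550ot1; shaAn (⟨1, -1, 0, -218275017, 988210757141⟩ : WeierstrassCurve ℚ) = (qd : ℂ))
    (hvd : padicValRat 3 qd ≤ 0) :
    MissingUpperBoundAt W 3 := by
  subst hWeq
  haveI := isElliptic_sWd242550ot1; haveI := isGloballyMinimal_sWd242550ot1
  have hI : integralModelInt (⟨1, -1, 1, -62705, -4795703⟩ : WeierstrassCurve ℚ) = (⟨1, -1, 1, -62705, -4795703⟩ : WeierstrassCurve ℤ) :=
    integralModelInt_eq_of_map_eq _ (map_mk_int 1 (-1) 1 (-62705) (-4795703))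
  have hGS := subGss_three_242550ot1 (W := (⟨1, -1, 1, -62705, -4795703⟩ : WeierstrassCurve ℚ)) rfl
  have hsurj := surj_three_242550ot1 (W := (⟨1, -1, 1, -62705, -4795703⟩ : WeierstrassCurve ℚ)) rfl
  haveI : Fact ((-59 : ℤ) < 0) := ⟨by norm_num⟩; haveI : Fact (Nat.Prime 7) := ⟨by norm_num⟩
  haveI : Fact (Nat.Prime 11) := ⟨by norm_num⟩; haveI : Fact (Nat.Prime 2) := ⟨by norm_num⟩
  have hbad₁ := WeierstrassCurve.not_hasGoodReductionAtPrime_of_dvd_minimalDiscriminantInt (⟨1, -1, 1, -62705, -4795703⟩ : WeierstrassCurve ℚ) 7 (by rw [IntModel.minimalDiscriminantInt_eq hI, Δ_eq_242550ot1]; norm_num)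
  have hm₁ : (⟨1, -1, 1, -62705, -4795703⟩ : WeierstrassCurve ℚ).HasMultiplicativeReductionAtPrime 11 := IntModel.hasMultiplicativeReductionAtPrime_of_intModel hI 11 (by rw [Δ_eq_242550ot1]; norm_num) (by rw [c₄_eq_242550ot1]; norm_num)
  have hm₂ : (⟨1, -1, 1, -62705, -4795703⟩ : WeierstrassCurve ℚ).HasMultiplicativeReductionAtPrime 2 := IntModel.hasMultiplicativeReductionAtPrime_of_intModel hI 2 (by rw [Δ_eq_242550ot1]; norm_num) (by rw [c₄_eq_242550ot1]; norm_num)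
  have hFC : ∀ (ℓ : ℕ) [Fact ℓ.Prime], ℓ ≠ 11 → ℓ ≠ 2 → ℓ ≠ 7 → (⟨1, -1, 1, -62705, -4795703⟩ : WeierstrassCurve ℚ).HasSplitMultiplicativeReductionAtPrime ℓ →
      ¬ 3 ∣ padicValInt ℓ (⟨1, -1, 1, -62705, -4795703⟩ : WeierstrassCurve ℚ).minimalDiscriminantInt := by
    intro ℓ hℓF hne₁ hne₂ hneq hs
    have hd := dvd_minimalDiscriminantInt_of_mult _ ℓ hs.hasMultiplicativeReductionAtPrime
    rw [IntModel.minimalDiscriminantInt_eq hI, Δ_eq_242550ot1] at hd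
    have hmem := mem_of_prime_dvd_of_prodPow_eq _ krausList_242550ot1 hℓF.out hd
    simp only [List.map_cons, List.map_nil, List.mem_cons, List.not_mem_nil, or_false] at hmem
    rcases hmem with rfl | rfl | rfl | rfl | rfl
    · exact absurd rfl hne₂
    · exact absurd hs.hasMultiplicativeReductionAtPrime (X9.PrintCert.not_hasMultiplicativeReductionAtPrime_of_dvd_of_dvd hI 3 (by rw [Δ_eq_242550ot1]; norm_num) (by rw [c₄_eq_242550ot1]; norm_num))
    · exact absurd hs.hasMultiplicativeReductionAtPrime (X9.PrintCert.not_hasMultiplicativeReductionAtPrime_of_dvd_of_dvd hI 5 (by rw [Δ_eq_242550ot1]; norm_num) (by rw [c₄_eq_242550ot1]; norm_num))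
    · exact absurd rfl hneq
    · exact absurd rfl hne₁
  have hshape : ∀ (q : ℕ) [Fact q.Prime], q ≠ 7 → 3 ∣ ((⟨1, -1, 1, -62705, -4795703⟩ : WeierstrassCurve ℚ).baseChange ℚ_[q]).localTamagawaNumber ℤ_[q] →
      (⟨1, -1, 1, -62705, -4795703⟩ : WeierstrassCurve ℚ).HasSplitMultiplicativeReductionAtPrime q := by
    intro q hqF hq h3
    by_cases hd : (q : ℤ) ∣ minimalDiscriminantInt (⟨1, -1, 1, -62705, -4795703⟩ : WeierstrassCurve ℚ)
    swap
    · exact absurd h3 (not_three_dvd_localTamagawaNumber_of_not_dvd _ q hd)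
    rw [IntModel.minimalDiscriminantInt_eq hI, Δ_eq_242550ot1] at hd
    have hmem := mem_of_prime_dvd_of_prodPow_eq _ krausList_242550ot1 hqF.out hd
    simp only [List.map_cons, List.map_nil, List.mem_cons, List.not_mem_nil, or_false] at hmem
    rcases hmem with rfl | rfl | rfl | rfl | rfl
    · exact (Koly.split_and_three_dvd_of_mult_of_three_dvd_localTamagawaNumber _ 2 (IntModel.hasMultiplicativeReductionAtPrime_of_intModel hI 2 (by rw [Δ_eq_242550ot1]; norm_num) (by rw [c₄_eq_242550ot1]; norm_num)) h3).1
    · have hc3 : ((⟨1, -1, 1, -62705, -4795703⟩ : WeierstrassCurve ℚ).baseChange ℚ_[3]).localTamagawaNumber ℤ_[3] = 1 := -- additive `3` (I0*): Tate certificate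
        (IntModelTam.localTamagawaNumber_padic_eq_of_intModel_of_tamZ hI 3 (F := ⟨3, 9, 1, 1, 8, 6, 0, 0⟩) rfl (by decide +kernel)).trans (by decide)
      rw [hc3] at h3; exact absurd h3 (by decide)
    · have hc5 : ((⟨1, -1, 1, -62705, -4795703⟩ : WeierstrassCurve ℚ).baseChange ℚ_[5]).localTamagawaNumber ℤ_[5] = 2 := -- additive `5` (I0*): Tate certificate
        (IntModelTam.localTamagawaNumber_padic_eq_of_intModel_of_tamZ hI 5 (F := ⟨5, 9, 4, 2, 10, 6, 0, 1⟩) rfl (by decide +kernel)).trans (by decide)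
      rw [hc5] at h3; exact absurd h3 (by decide)
    · exact absurd rfl hq
    · exact (Koly.split_and_three_dvd_of_mult_of_three_dvd_localTamagawaNumber _ 11 (IntModel.hasMultiplicativeReductionAtPrime_of_intModel hI 11 (by rw [Δ_eq_242550ot1]; norm_num) (by rw [c₄_eq_242550ot1]; norm_num)) h3).1
  have hjac : ∀ ℓ : ℕ, ℓ.Prime → ℓ ∣ (⟨1, -1, 1, -62705, -4795703⟩ : WeierstrassCurve ℚ).conductorNorm ℤ → ℓ ≠ 11 → ℓ ≠ 2 → ℓ ≠ 2 →
      jacobiSym (-59) ℓ = 1 := by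
    intro ℓ hℓ hℓN hne₁ hne₂ hℓ2
    rw [hN] at hℓN
    have hmem : ℓ ∈ Nat.primeFactors 242550 := Nat.mem_primeFactors.mpr ⟨hℓ, hℓN, by norm_num⟩
    rw [show Nat.primeFactors 242550 = {2, 3, 5, 7, 11} by decide +kernel] at hmem
    simp only [Finset.mem_insert, Finset.mem_singleton] at hmem
    rcases hmem with rfl | rfl | rfl | rfl | rfl
    · exact absurd rfl hne₂
    · norm_num [jacobiSym.mod_left]
    · norm_num [jacobiSym.mod_left]
    · norm_num [jacobiSym.mod_left]
    · exact absurd rfl hne₁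
  have hWd : (⟨1, (-15 : ℚ), ((1:ℚ)/2), (0 : ℚ)⟩ : VariableChange ℚ) • (⟨1, -1, 1, -62705, -4795703⟩ : WeierstrassCurve ℚ).quadraticTwist (((-59 : ℤ) : ℚ)) =
      (⟨1, -1, 0, -218275017, 988210757141⟩ : WeierstrassCurve ℚ) := by
    push_cast; ext <;> simp [WeierstrassCurve.variableChange_a₁, WeierstrassCurve.variableChange_a₂,
      WeierstrassCurve.variableChange_a₃, WeierstrassCurve.variableChange_a₄, WeierstrassCurve.variableChange_a₆,
      WeierstrassCurve.quadraticTwist, WeierstrassCurve.b₂, WeierstrassCurve.b₄, WeierstrassCurve.b₆] <;> norm_num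
  exact leafRankZeroUpper_three_at_saving_of_sqrtField hGZK hmod hnf hJL hCO hPrim _ hGS.1 hGS.2 hr hsurj rfl Dt hc 7 hbad₁
    (s₁ := 11) (s₂ := 2) (by decide) (by decide) (by decide) hm₁ hm₂ hFC hshape
    (Or.inl (by rw [IntModel.minimalDiscriminantInt_eq hI, Δ_eq_242550ot1, IntModel.padicValInt_eq_of_dvd_of_not_dvd 11 (e := 1) (by norm_num) (by norm_num)]; decide))
    (-59) (by norm_num) (by rw [show (-59 : ℤ).natAbs = 59 by rfl, Nat.squarefree_iff_nodup_primeFactorsList (by norm_num)]; simp)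
    (Or.inr ⟨by decide, by norm_num [jacobiSym.mod_left]⟩) (by norm_num) (Or.inl ⟨rfl, by norm_num⟩) (by norm_num) hjac
    (fun _ _ h ↦ absurd rfl h) hLt0 hLt1 _ _ hWd hqd hvd

end Summit.BirchSwinnertonDyer.BirchSwinnertonDyer.Theorems.RamifiedHeegnerPairTwistUnitSaving

end
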